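import Mathlib
import Summits.Ventures.DiscreteObjects.Mahler.CensusKernelDeg10B
import Summits.Ventures.DiscreteObjects.Mahler.CensusKernelDeg10C

/-!
# Kernel census, degree 10 (part D (assembly)): every irreducible integer polynomial of degree 10 with `1 < M < 13/10` is one of the 7 census cores

Cell `pub-namedobj`, seat `pub-namedobj-mahler-g12`. Framing: lottery ticket; floor = certified bounds/negative
ranges.

`DegreeCensus 10 (13/10) coresDeg10` as a THEOREM of the Lean kernel (standard axioms; `decide` with kernel reduction in
21 chunks `c₁ = -10, …, 10`, no `native_decide`): the search `censusSearch T10 5 []` (41097 leaves, 557 survivors of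
the 20 power-sum tests `|P_k| ≤ ⌈8+(13/10)^k+(10/13)^k⌉-1`) is run by the kernel and every survivor is discharged by a
certificate (2 cyc, 14 exc, 114 grf, 427 red; Graeffe depth ≤ 11); soundness is `degreeCensus_of_certified` (`CensusCertificate`).
Part A: thresholds and chunks `c₁ ≤ -2`; part B: chunks `c₁ ∈ {{-1,0,1}}`; part C: chunks `c₁ ≥ 2`; part D: assembly and the
theorem `degreeCensus_ten`. This re-derives, inside the kernel, Boyd's (1980) complete degree-10 list of measures below 1.3
(7 polynomials up to `±x`; complete lists to degree 44: Mossinghoff–Rhin–Wu 2008) — a CONTROL/replication row, not new ground.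
-/

namespace Summit.Ventures.DiscreteObjects.Mahler

open Polynomial

/-- Every survivor of the degree-10 search is certified (assembled from the 21 chunks). -/
theorem certified10 : ∀ a ∈ censusSearch T10 5 [],
    ∃ c, checkCert 13 10 10 coresDeg10 (1 :: palC a) c = true := by
  intro a ha
  rw [mem_censusSearch_succ_nil_iff] at ha
  obtain ⟨a1, ha1, ha⟩ := ha
  rw [mem_icc, show ((T10.getD 0 0 : ℕ) : ℤ) = 10 from rfl] at ha1
  obtain ⟨hlo, hhi⟩ := ha1
  interval_cases a1
  · exact exists_cert_of_allCertified _ _ certified10_m10 a ha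
  · exact exists_cert_of_allCertified _ _ certified10_m9 a ha
  · exact exists_cert_of_allCertified _ _ certified10_m8 a ha
  · exact exists_cert_of_allCertified _ _ certified10_m7 a ha
  · exact exists_cert_of_allCertified _ _ certified10_m6 a ha
  · exact exists_cert_of_allCertified _ _ certified10_m5 a ha
  · exact exists_cert_of_allCertified _ _ certified10_m4 a ha
  · exact exists_cert_of_allCertified _ _ certified10_m3 a ha
  · exact exists_cert_of_allCertified _ _ certified10_m2 a ha
  · exact exists_cert_of_allCertified _ _ certified10_m1 a ha
  · exact exists_cert_of_allCertified _ _ certified10_p0 a ha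
  · exact exists_cert_of_allCertified _ _ certified10_p1 a ha
  · exact exists_cert_of_allCertified _ _ certified10_p2 a ha
  · exact exists_cert_of_allCertified _ _ certified10_p3 a ha
  · exact exists_cert_of_allCertified _ _ certified10_p4 a ha
  · exact exists_cert_of_allCertified _ _ certified10_p5 a ha
  · exact exists_cert_of_allCertified _ _ certified10_p6 a ha
  · exact exists_cert_of_allCertified _ _ certified10_p7 a ha
  · exact exists_cert_of_allCertified _ _ certified10_p8 a ha
  · exact exists_cert_of_allCertified _ _ certified10_p9 a ha
  · exact exists_cert_of_allCertified _ _ certified10_p10 a ha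

/-- **Degree-10 census below `13/10` (kernel theorem):** `DegreeCensus 10 (13/10) coresDeg10` — every irreducible
`P ∈ ℤ[X]` of degree `10` with `1 < M(P) < 1.3` is `± c(± x)` for one of the 7 listed cores (Lehmer's polynomial first). -/
theorem degreeCensus_ten : DegreeCensus 10 (13 / 10) coresDeg10 := by
  have h := degreeCensus_of_certified (Bn := 13) (Bd := 10) (d := 5) (by norm_num) (by norm_num) (by decide)
    thresholdsValid_T10 (by have := smythTheta_gt; push_cast; linarith) certified10
  norm_num at h
  exact h

end Summit.Ventures.DiscreteObjects.Mahler
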